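import Literature.MathematicalPhysics.QuantumFieldTheory.Balaban1983to89.B6Prop26HolderDivAdmissibleV1
import Literature.MathematicalPhysics.QuantumFieldTheory.Balaban1983to89.B6HolderPairGeometryV1

/-!
# `Balaban1983to89.B6Prop26HolderDivCensusV1` — T. Bałaban, *Propagators and renormalization transformations for lattice gauge theories. II*,
# Commun. Math. Phys. **96** (1984) 223–250 [Balaban1984PropagatorsII], Prop. 2.6 p. 247, THE HÖLDER ENTRY (2.137)₂ `‖ζG∇*J‖_α` AT k LEVELS FOR THE
# GENUINE `G = Δ_a⁻¹` ON THE V1 TORUS — THE FULL ADMISSIBLE RANGE `|x − x′|_∞ ≤ L^{j}` IN THE CENSUS SHAPE (one rate and one threshold chosen before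
# the Hölder exponent): near pairs from `…B6Prop26HolderDivAdmissibleV1`, far pairs from the sup entry (2.136)₃ at both points and p22's window geometry

statement-level skeleton of published theorems with citation tags; proofs where landed; nothing here is a claim about the Yang–Mills mass gap

PDF held: `paper:balaban1984-cmp96-propagators-rt-ii` (journal page = PDF page + 222), p. 247 [PDF 25]: *"‖ζ∇GJ‖_α, ‖ζG∇*J‖_α ≤ O(1)(Lʲη)^{1−α}(‖ζ‖^ξ_α +
|ζ|)e^{−δ₃d(y,y′)}|J|, ξ = L^{−j} (2.137) for 0 ≤ α < 1, ζ ∈ C₀^∞(Δ̃(y)) …, supp J ⊂ Δ(y′), with the constant O(1) depending on d, L and α (O(1) → ∞ if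
α → 1)"*; *"Reasoning in the same way as in the proof of Proposition 2.2 we obtain Proposition 2.6"*; [4] (1.109) p. 35: *"‖A‖_α = max_μ sup_{x,x′:
|x−x′| ≤ 1} |x − x′|^{−α}|A_μ(x) − A_μ(x′)|"* (the Hölder quotient over pairs at distance at most the scale `ξ`).

CITATION HEADER (lean-in-tree rule) — WHAT IS REPRODUCED.  Phase-2 file of the `lit-balaban` typed skeleton (HOME `run/shared/lean/pub/lit-balaban/`),
seat **p38 gen 34** (free target (2.137)₂ at k levels, protocol G.5-34(d)); SKELETON row **B6.Prop2.6** (cells only; head and decls of record untouched,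
owner r03).  THE RESULT, in the shape the k-level census of `B6.Prop26Printed` consumes (r03 g26, `B6Prop26Census2137KLevelV1` input `hm2`):
* **`prop26_2137_div_kLevel_admissible`** — `∃ δ M₂ N₁, 0 < δ ∧ 0 < M₂ ∧ ∀ α ∈ [0,1), ∃ A ≥ 0, ∀ (admissible V1 torus: k ≥ 2, M_h = Lᵃ ≥ 8, R ≥ 2L²,
  P′ ≥ 5, L ≥ 5, cubes placed, M₂ ≤ L·M_h, N₁ + 1 ≤ R·L·M_h) (c′ ≠ 0) (weights in the global band) ν (x x′ : fine bonds), x.dir = x′.dir →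
  |x − x′|_∞ ≤ L^{j(y(x))} → |x − x′|_∞ ≤ L^{j(y(x′))} → HasMajorant (P_{x,x′}·G·∇*_ν) (A·(|x − x′|_∞/L^{j(y(x))})^α·(L^{j(y)}|c′|⁻¹)·e^{−δ d_T(y,y′)})`,
  i.e. for `J` supported in `B(y′)`: `|(G∇*_νJ)(x) − (G∇*_νJ)(x′)| ≤ A·(|x − x′|_∞/L^{j(y(x))})^α·L^{j(y(x))}|c′|⁻¹·e^{−δ d_T(y(x),y′)}·|J|` — print's
  `O(1)(Lʲη)^{1−α}|x − x′|^α e^{−δ₃d}|J|` with `ξ = L^{−j}`, `η⁻¹ = |c′|`, for EVERY pair at distance at most the scale of either point.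
THE PROOF.  NEAR pairs (`|x − x′|_∞ ≤ L^{j−2}` at both points): `…B6Prop26HolderDivAdmissibleV1.prop26_2137_div_kLevel_near_out` at `σ := σ₀`, walk
exponent `½`, transport budget `σ₀/2` (rate `σ₀/4`), its two side conditions discharged from `N₁` (`budget_lt_one`, `transport_of_le`, private).
FAR pairs: `|f(x) − f(x′)| ≤ |f(x)| + |f(x′)|` with the sup entry (2.136)₃ in census shape (`…B6Prop26DivLegKLevelV1.prop26_2136_div_kLevel_census`) at
both points; the bound at `x′` is moved to the block of `x` by p22's window geometry of the cube carrying `x` (`Σ_□ h_□(x)² = 1`):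
`…B6HolderPairGeometryV1.pair_levels` (`|j(y(x)) − j(y(x′))| ≤ 1`, so `L^{j(y(x′))} ≤ L·L^{j(y(x))}`) and `pair_distT_le` (`d_T(y(x), y(x′)) ≤ (d+1)(L+2)`,
so `e^{−δ₃d_T(y(x′),y′)} ≤ e^{δ₃(d+1)(L+2)}e^{−δ₃d_T(y(x),y′)}` by (2.54)); far means `t = |x − x′|_∞/L^{j(y(x))} > L^{−3}`, whence `1 ≤ L³t ≤ L³t^α`.
IMPORTS BY NAME, restating nothing; THEOREMS ONLY (no `def`, no `def … : Prop`, no new hypothesis); standard axioms.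

HONEST SCOPE / DIVERGENCES.  (1) Print proves (2.137) by *"Reasoning in the same way as in the proof of Proposition 2.2"*; the two-sided walk, the
near/far split at `L^{j−2}` and all constants are OURS (HOME/GAPS.md G-B6-2137-2); no mathematical gap in the source is claimed.  (2) `α < 1` as in
print: the member constant of the near input `C_E(α) → ∞` as `α → 1`; the rate `δ` and the thresholds do not depend on `α`.  (3) The cut-off `ζ` of
`‖ζG∇*J‖_α` is put on by the census (product rule, r03's `holderQ_le_of_pair_entry`) — not here.  (4) Setting as in the imported files (V1 torus, `k ≥ 2`,
`M_h = Lᵃ ≥ 8`, `R ≥ 2L²`, `P′ ≥ 5`, odd `L ≥ 5`, cubes placed, global band); constants on `d, L, b₀, b₁, α`, not optimised.  Integer tori, lattice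
units; nothing on d = 4 specifically or the continuum; NOT summit progress.  Unit `lit-balaban-p38` (gen 34), 2026-08-24.
-/

open scoped BigOperators
open Finset

namespace Literature.MathematicalPhysics.QuantumFieldTheory.Balaban1983to89.B6Prop26HolderDivCensusV1

open LatticeFieldCalculus
open B6MultiLevelBoxOperator (N0)
open B6MultiLevelTorusOperator (TDomains)
open B6Cover236MultiLevelBlocks (cubes)
open B6Geom246MultiLevelBox (bset)
open B6Geom246MultiLevelTorus (geomT triangle_refl_nonneg_T)
open B8Ineq192MultiLevelTorus (geomT_len)
open B6RandomWalk (HasMajorant hasMajorant_mono)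
open B6Ineq2133TwoScaleV1 (onFun)
open B6GlobalChartV1 (PV domT blkV1)
open B6SectAOperatorsV1 (BondIdx)
open B6SectAVectorModelV1 (GE)
open B6Partition118KLevelTorusCentral (one_le_of_four_le)
open B6Prop26KLevelSkeletonV1 (hB sum_hB_sq)
open B6Prop26KLevelAssemblyV1 (distT_nonneg)
open B6CubeWindowV1 (j0 Placed GlobalBand one_le_of_eight_le four_le_of_five_le)
open B6HolderPairMemberV1 (pairOp hasMajorant_pairOp_mul)
open B6HolderPairGeometryV1 (pair_levels pair_distT_le)
open B6Prop26HolderDivAdmissibleV1 (prop26_2137_div_kLevel_near_out)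
open B6Prop26DivLegKLevelV1 (prop26_2136_div_kLevel_census)
open B6LapLegKLevelV1 (DVa)

variable {d ℓ : ℕ} {hd : 1 ≤ d + 1} {hL : Odd (ℓ + 1) ∧ 1 < ℓ + 1} {m K : ℕ} {Mh k R : ℕ} {P' : Fin (d + 1) → ℕ}

/-! ## §1  Side conditions and elementary facts -/

/-- `t ≤ t^α` for `t ∈ [0,1]`, `α ∈ [0,1]`. [folklore] -/
private theorem le_rpow_self {t α : ℝ} (ht0 : 0 ≤ t) (ht1 : t ≤ 1) (hα0 : 0 ≤ α) (hα1 : α ≤ 1) : t ≤ t ^ α := by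
  have := Real.rpow_le_rpow_of_exponent_ge' ht0 ht1 hα0 hα1
  rwa [Real.rpow_one] at this


/-- the budget inequality `e^{−ασ}·L^{2(d+1)/N₀} < 1` for `N₀ := ⌈2(d+1)·log L/(ασ)⌉₊ + 1` (`α, σ > 0`); the private helper of
`…B6Prop26LapKLevelV1`, re-proved. [folklore] -/
private theorem budget_lt_one {d ℓ : ℕ} {α σ : ℝ} (hα : 0 < α) (hσ : 0 < σ) :
    Real.exp (-(α * σ)) * ((ℓ : ℝ) + 1) ^ ((2 * (d + 1 : ℕ) : ℝ) / (⌈2 * ((d : ℝ) + 1) * Real.log ((ℓ : ℝ) + 1) / (α * σ)⌉₊ + 1 : ℕ)) < 1 := by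
  have hL : (0 : ℝ) < (ℓ : ℝ) + 1 := by positivity
  have hlog : 0 ≤ Real.log ((ℓ : ℝ) + 1) := Real.log_nonneg (by linarith [(Nat.cast_nonneg ℓ : (0 : ℝ) ≤ ℓ)])
  have hN : 2 * ((d : ℝ) + 1) * Real.log ((ℓ : ℝ) + 1) / (α * σ) <
      ((⌈2 * ((d : ℝ) + 1) * Real.log ((ℓ : ℝ) + 1) / (α * σ)⌉₊ + 1 : ℕ) : ℝ) := by
    push_cast
    exact lt_of_le_of_lt (Nat.le_ceil _) (lt_add_one _)
  have hNpos : (0 : ℝ) < ((⌈2 * ((d : ℝ) + 1) * Real.log ((ℓ : ℝ) + 1) / (α * σ)⌉₊ + 1 : ℕ) : ℝ) := by positivity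
  have hασ : 0 < α * σ := mul_pos hα hσ
  have key : (2 * (d + 1 : ℕ) : ℝ) / (⌈2 * ((d : ℝ) + 1) * Real.log ((ℓ : ℝ) + 1) / (α * σ)⌉₊ + 1 : ℕ) * Real.log ((ℓ : ℝ) + 1) < α * σ := by
    rw [div_mul_eq_mul_div, div_lt_iff₀ hNpos]
    rw [div_lt_iff₀ hασ] at hN
    push_cast at hN ⊢
    nlinarith
  rw [Real.rpow_def_of_pos hL, ← Real.exp_add, Real.exp_lt_one_iff]
  nlinarith

/-- the transport condition `2 log L ≤ τ·(R·L·M_h − 1)` from `⌈2 log L/τ⌉₊ ≤ N` and `N + 1 ≤ R·L·M_h` (`τ > 0`). [folklore] -/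
private theorem transport_of_le {ℓ Mh R N : ℕ} {τ : ℝ} (hτ : 0 < τ) (hN : ⌈2 * Real.log ((ℓ : ℝ) + 1) / τ⌉₊ ≤ N)
    (hRM : N + 1 ≤ R * ((ℓ + 1) * Mh)) : 2 * Real.log ((ℓ : ℝ) + 1) ≤ τ * (((R * ((ℓ + 1) * Mh) - 1 : ℕ)) : ℝ) := by
  have h1 : 2 * Real.log ((ℓ : ℝ) + 1) / τ ≤ (N : ℝ) := (Nat.le_ceil _).trans (by exact_mod_cast hN)
  have h2 : (N : ℝ) ≤ (((R * ((ℓ + 1) * Mh) - 1 : ℕ)) : ℝ) := by exact_mod_cast (by omega : N ≤ R * ((ℓ + 1) * Mh) - 1)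
  rw [div_le_iff₀ hτ] at h1
  nlinarith

/-- `|z − z|_∞ = 0`. [folklore] -/
private theorem supDist_self' (z : Site (PV d ℓ m K hd hL) 0) : supDist z z = 0 := by
  unfold supDist
  simp

/-- every fine bond is ACTIVE for some cube: `Σ_□ h_□(x)² = 1` forces `h_□(x) ≠ 0` for some `□`. [cite: Balaban1984PropagatorsII, (2.36) p.229] -/
private theorem exists_hB_ne_zero (hN : ∀ μ, N0 ℓ Mh k P' μ = (PV d ℓ m K hd hL).sitesPerDir 0) (D : TDomains d ℓ Mh k P' R)
    (hMh1 : 1 ≤ Mh) (hP : ∀ μ, 1 ≤ P' μ) (x : PBond (PV d ℓ m K hd hL) 0) : ∃ c : ↥(cubes D.toDomains), hB hN D c x ≠ 0 := by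
  by_contra hno
  simp only [not_exists, ne_eq, not_not] at hno
  have h := sum_hB_sq hN D hMh1 hP x
  have h0 : ∑ c ∈ Finset.univ, hB hN D c x ^ 2 = 0 := Finset.sum_eq_zero fun c _ => by rw [hno c]; ring
  linarith

/-! ## §2  (2.137)₂ at k levels on the full admissible range, census shape -/

set_option maxHeartbeats 1600000 in
open Classical in
/-- **PROPOSITION 2.6 (2.137)₂ `‖ζG∇*J‖_α` AT k LEVELS FOR THE GENUINE `G = Δ_a⁻¹` ON THE FULL ADMISSIBLE RANGE — CENSUS SHAPE, NO DISPLAYED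
HYPOTHESIS** (the input `hm2` of the k-level census of `B6.Prop26Printed`, fold owner r03 g26): ONE rate `δ > 0` and the torus-size thresholds `M₂`, `N₁`
chosen ONCE for the weight band, then for every Hölder exponent `0 ≤ α < 1` a constant `A(α)`, with: on every admissible V1 torus (`k ≥ 2`, `M_h = Lᵃ ≥ 8`,
`R ≥ 2L²`, `P′ ≥ 5`, `L ≥ 5`, cubes placed, `M₂ ≤ L·M_h`, `N₁ + 1 ≤ R·L·M_h`), for every `c′ ≠ 0`, positive weights in the global band, direction `ν`
and every ADMISSIBLE pair of fine bonds — `x.dir = x′.dir`, `|x − x′|_∞ ≤ L^{j(y(x))}`, `|x − x′|_∞ ≤ L^{j(y(x′))}` (print's `|x − x′| ≤ ξ = L^{−j}` at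
both points) —
`HasMajorant (P_{x,x′}·G·∇*_ν) (A·(|x − x′|_∞/L^{j(y(x))})^α·(L^{j(y)}|c′|⁻¹)·e^{−δ d_T(y,y′)})`, i.e. for `J` supported in `B(y′)`:
`|(G∇*_νJ)(x) − (G∇*_νJ)(x′)| ≤ A·(|x − x′|_∞/L^{j(y(x))})^α·L^{j(y(x))}|c′|⁻¹·e^{−δ d_T(y(x),y′)}·|J|` — print's
`‖ζG∇*J‖_α ≤ O(1)(Lʲη)^{1−α}(…)e^{−δ₃d(y,y′)}|J|` before the cut-off `ζ` is put on (product rule, census side).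
PROOF.  NEAR pairs (`|x − x′|_∞ ≤ L^{j−2}` at both points): `prop26_2137_div_kLevel_near_out` at `σ := σ₀`, walk exponent `½`, `τ_b := σ₀/2` (rate
`σ₀/4`), the side conditions from `N₁` (`budget_lt_one`, `transport_of_le`).  FAR pairs: `|f(x) − f(x′)| ≤ |f(x)| + |f(x′)|` with the sup entry (2.136)₃
(`…B6Prop26DivLegKLevelV1.prop26_2136_div_kLevel_census`) at both points; the bound at `x′` is moved to the block of `x` by p22's window geometry for the
cube carrying `x` (`pair_levels`: `|j(y(x)) − j(y(x′))| ≤ 1`, so `L^{j(y(x′))} ≤ L·L^{j(y(x))}`; `pair_distT_le`: `d_T(y(x), y(x′)) ≤ (d+1)(L+2)`, so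
`e^{−δ₃d_T(y(x′),y′)} ≤ e^{δ₃(d+1)(L+2)}e^{−δ₃d_T(y(x),y′)}` by (2.54)); far means `t = |x − x′|_∞/L^{j(y(x))} > L^{−3}`, whence `1 ≤ L³t ≤ L³t^α`.
[cite: Balaban1984PropagatorsII, Prop. 2.6 (2.137) p.247 (second member; «for 0 ≤ α < 1 … with the constant O(1) depending on d, L and α»), (2.136)
p.247 (third entry), (2.141) p.247, (2.54) p.232, (2.36) p.229, Lemma 2.1 p.234; Balaban1984PropagatorsI, (1.109) p.35] -/
theorem prop26_2137_div_kLevel_admissible (d ℓ : ℕ) (hd : 1 ≤ d + 1) (hL : Odd (ℓ + 1) ∧ 1 < ℓ + 1) {b₀ b₁ : ℝ} (hb₀ : 0 < b₀) (hb₁ : b₀ ≤ b₁) :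
    ∃ (δ M₂ : ℝ) (N₁ : ℕ), 0 < δ ∧ 0 < M₂ ∧ ∀ (α : ℝ), 0 ≤ α → α < 1 → ∃ A : ℝ, 0 ≤ A ∧
      ∀ (m K : ℕ) {Mh k R : ℕ} {P' : Fin (d + 1) → ℕ}
        (hN : ∀ μ, N0 ℓ Mh k P' μ = (PV d ℓ m K hd hL).sitesPerDir 0) (D : TDomains d ℓ Mh k P' R) (hk : k ≤ m + K) (_ : 2 ≤ k)
        {a : ℕ} (_ : Mh = (ℓ + 1) ^ a) (_ : 8 ≤ Mh) (_ : 2 * (ℓ + 1) ^ 2 ≤ R) (_ : ∀ μ, 5 ≤ P' μ) (_ : 4 ≤ ℓ)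
        (_ : ∀ c : ↥(cubes D.toDomains), Placed ℓ k P' c.1) (_ : M₂ ≤ ((ℓ : ℝ) + 1) * Mh) (_ : N₁ + 1 ≤ R * ((ℓ + 1) * Mh))
        {cf : ℝ} (hcf : cf ≠ 0) {w : BondIdx (domT hN D hk) → ℝ} (hw : ∀ i, 0 < w i) (_ : GlobalBand b₀ b₁ cf w)
        (ν : Fin (d + 1)) (x x' : PBond (PV d ℓ m K hd hL) 0), x.dir = x'.dir →
        supDist x.src x'.src ≤ (ℓ + 1) ^ (blkV1 hN D x).1.1 → supDist x.src x'.src ≤ (ℓ + 1) ^ (blkV1 hN D x').1.1 →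
        HasMajorant (g := geomT D) (blkV1 hN D) (pairOp x x' * onFun (GE (domT hN D hk) hcf hw) * DVa ν cf)
          (fun y y' => A * ((((supDist x.src x'.src : ℕ) : ℝ) / (((ℓ + 1 : ℕ) : ℝ)) ^ (blkV1 hN D x).1.1) ^ α *
            ((geomT D).len y * |cf|⁻¹)) * Real.exp (-(δ * (geomT D).dist y y'))) := by
  -- the near-pair input at `σ := σ₀`, walk exponent `½`, `N₀ := Nb`, `τ_b := σ₀/2` (rate `σ₀/4`)
  obtain ⟨σ₀, hσ₀, hnear⟩ := prop26_2137_div_kLevel_near_out d ℓ hd hL hb₀ hb₁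
  obtain ⟨M₁, hM₁, hnearα⟩ := hnear σ₀ hσ₀ le_rfl (1 / 2) (by norm_num) (by norm_num)
    (⌈2 * ((d : ℝ) + 1) * Real.log ((ℓ : ℝ) + 1) / (1 / 2 * σ₀)⌉₊ + 1) (Nat.succ_pos _) (τb := σ₀ / 2) (by positivity) (by linarith)
  -- the sup entry (2.136)₃ in census shape
  obtain ⟨δ₃, A₃, M₃, N₃, hδ₃, hA₃, hM₃, h3⟩ := prop26_2136_div_kLevel_census d ℓ hd hL hb₀ hb₁
  refine ⟨min (σ₀ / 4) δ₃, max M₁ M₃,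
    max (max (⌈2 * ((d : ℝ) + 1) * Real.log ((ℓ : ℝ) + 1) / (1 / 2 * σ₀)⌉₊ + 1) ⌈2 * Real.log ((ℓ : ℝ) + 1) / (σ₀ / 2)⌉₊) N₃,
    lt_min (by positivity) hδ₃, lt_max_of_lt_left hM₁, fun α hα0 hα1 => ?_⟩
  obtain ⟨An, hAn, hN2⟩ := hnearα α hα0 hα1
  -- the geometric constants of the far case
  set r₀ : ℝ := ((d : ℝ) + 1) * (((ℓ : ℝ) + 1) + 1) with hr₀
  set Af : ℝ := A₃ * (1 + ((ℓ : ℝ) + 1) * Real.exp (δ₃ * r₀)) * ((ℓ : ℝ) + 1) ^ 3 with hAf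
  have hAf0 : 0 ≤ Af := by positivity
  refine ⟨An * ((ℓ : ℝ) + 1) + Af, by positivity, ?_⟩
  intro m K Mh k R P' hN D hk hk2 a hMha hM8 hR2 hP5 hℓ hpl hLM hRM cf hcf w hw hwb ν x x' hdir hs _hs'
  have hMh1 : 1 ≤ Mh := one_le_of_eight_le hM8
  have hP4 : ∀ μ, 4 ≤ P' μ := four_le_of_five_le hP5
  have hP : ∀ μ, 1 ≤ P' μ := one_le_of_four_le hP4
  have hL1 : (1 : ℝ) ≤ (ℓ : ℝ) + 1 := by linarith [(Nat.cast_nonneg ℓ : (0 : ℝ) ≤ ℓ)]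
  have hcast : (((ℓ + 1 : ℕ) : ℝ)) = (ℓ : ℝ) + 1 := by push_cast; ring
  have hdnn : ∀ y y' : (geomT D).Site, 0 ≤ (geomT D).dist y y' := distT_nonneg
  -- thresholds
  have hLM1 : M₁ ≤ ((ℓ : ℝ) + 1) * Mh := (le_max_left _ _).trans hLM
  have hLM3 : M₃ ≤ ((ℓ : ℝ) + 1) * Mh := (le_max_right _ _).trans hLM
  have hRMb : ⌈2 * ((d : ℝ) + 1) * Real.log ((ℓ : ℝ) + 1) / (1 / 2 * σ₀)⌉₊ + 1 + 1 ≤ R * ((ℓ + 1) * Mh) :=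
    le_trans (Nat.succ_le_succ ((le_max_left _ _).trans (le_max_left _ _))) hRM
  have hRM3 : N₃ + 1 ≤ R * ((ℓ + 1) * Mh) := le_trans (Nat.succ_le_succ (le_max_right _ _)) hRM
  have hθ := budget_lt_one (d := d) (ℓ := ℓ) (α := 1 / 2) (σ := σ₀) (by norm_num) hσ₀
  have hτ := transport_of_le (Mh := Mh) (R := R) (by positivity : (0 : ℝ) < σ₀ / 2) ((le_max_right _ _).trans (le_max_left _ N₃)) hRM
  -- the Hölder parameter
  obtain ⟨sd, hsd⟩ : ∃ s : ℕ, supDist x.src x'.src = s := ⟨_, rfl⟩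
  rw [hsd] at hs ⊢
  set t : ℝ := ((sd : ℕ) : ℝ) / (((ℓ + 1 : ℕ) : ℝ)) ^ (blkV1 hN D x).1.1 with ht
  have hpx : (0 : ℝ) < (((ℓ + 1 : ℕ) : ℝ)) ^ (blkV1 hN D x).1.1 := by positivity
  have ht0 : 0 ≤ t := by positivity
  have ht1 : t ≤ 1 := by
    rw [ht, div_le_one hpx]; exact_mod_cast hs
  have htα : t ≤ t ^ α := le_rpow_self ht0 ht1 hα0 hα1.le
  have htα0 : 0 ≤ t ^ α := Real.rpow_nonneg ht0 α
  have habs : 0 < |cf| := abs_pos.2 hcf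
  have hlenpos : ∀ y : (geomT D).Site, 0 < (geomT D).len y := fun y => by rw [geomT_len]; positivity
  have hlen0 : ∀ y : (geomT D).Site, 0 < (geomT D).len y * |cf|⁻¹ := fun y => by have := hlenpos y; positivity
  by_cases hnr : sd ≤ (ℓ + 1) ^ ((blkV1 hN D x).1.1 - 2) ∧ sd ≤ (ℓ + 1) ^ ((blkV1 hN D x').1.1 - 2)
  · -- ### NEAR pairs
    have hx := hN2 m K hN D hk hk2 hMha hM8 hR2 hP5 hℓ hpl hLM1 hRMb hθ hτ hcf hw hwb ν x x' hdir
      (by rw [hsd]; exact hnr.1) (by rw [hsd]; exact hnr.2)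
    rw [hsd] at hx
    refine hasMajorant_mono _ hx fun y y' => ?_
    have hly := hlenpos y
    have hl := (hlen0 y).le
    have hrate : Real.exp (-(((1 - 1 / 2) * σ₀ - σ₀ / 2 / 2) * (geomT D).dist y y')) ≤ Real.exp (-(min (σ₀ / 4) δ₃ * (geomT D).dist y y')) :=
      Real.exp_le_exp.2 (neg_le_neg (mul_le_mul_of_nonneg_right (by linarith [min_le_left (σ₀ / 4) δ₃]) (hdnn y y')))
    have hE := Real.exp_nonneg (-(min (σ₀ / 4) δ₃ * (geomT D).dist y y'))
    calc An * t ^ α * ((ℓ : ℝ) + 1) * ((geomT D).len y * |cf|⁻¹) * Real.exp (-(((1 - 1 / 2) * σ₀ - σ₀ / 2 / 2) * (geomT D).dist y y'))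
        ≤ An * t ^ α * ((ℓ : ℝ) + 1) * ((geomT D).len y * |cf|⁻¹) * Real.exp (-(min (σ₀ / 4) δ₃ * (geomT D).dist y y')) :=
          mul_le_mul_of_nonneg_left hrate (by positivity)
      _ = (An * ((ℓ : ℝ) + 1)) * (t ^ α * ((geomT D).len y * |cf|⁻¹)) * Real.exp (-(min (σ₀ / 4) δ₃ * (geomT D).dist y y')) := by ring
      _ ≤ (An * ((ℓ : ℝ) + 1) + Af) * (t ^ α * ((geomT D).len y * |cf|⁻¹)) * Real.exp (-(min (σ₀ / 4) δ₃ * (geomT D).dist y y')) := by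
          gcongr; linarith
  · -- ### FAR pairs: the sup entry at both points
    have hE3 := h3 m K hN D hk hk2 hMha hM8 hR2 hP5 hℓ hpl hLM3 hRM3 hcf hw hwb ν
    -- the cube carrying `x` and the window geometry of the pair
    obtain ⟨c, hc⟩ := exists_hB_ne_zero hN D hMh1 hP x
    have hlevx := (pair_levels hN D hk (hMh1 := hMh1) (hP4 := hP4) hMha c hM8 hR2 (hpl c) ν (x := x) (x' := x) (Or.inl hc)
      (by rw [supDist_self']; exact Nat.zero_le _)).1
    have hdist : supDist x.src x'.src ≤ (ℓ + 1) ^ (j0 hMh1 hP4 c + 1) := by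
      rw [hsd]; exact hs.trans (Nat.pow_le_pow_right (Nat.succ_pos ℓ) hlevx.2)
    have hG1 := pair_levels hN D hk (hMh1 := hMh1) (hP4 := hP4) hMha c hM8 hR2 (hpl c) ν (x := x) (x' := x') (Or.inl hc) hdist
    have hG2 := pair_distT_le hN D hk (hMh1 := hMh1) (hP4 := hP4) hMha c hM8 hR2 (hpl c) ν (x := x) (x' := x') (Or.inl hc) hdist
    have hjj : (blkV1 hN D x').1.1 ≤ (blkV1 hN D x).1.1 + 1 := by omega
    have hjj' : (blkV1 hN D x).1.1 ≤ (blkV1 hN D x').1.1 + 1 := by omega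
    -- far ⇒ `L^{j(y(x)) − 3} < |x − x′|_∞`, hence `1 ≤ L³·t ≤ L³·t^α`
    have hfar : (ℓ + 1) ^ ((blkV1 hN D x).1.1 - 3) < sd := by
      rcases not_and_or.mp hnr with h | h
      · exact lt_of_le_of_lt (Nat.pow_le_pow_right (Nat.succ_pos ℓ) (by omega)) (not_le.mp h)
      · exact lt_of_le_of_lt (Nat.pow_le_pow_right (Nat.succ_pos ℓ) (by omega)) (not_le.mp h)
    have hkey : (((ℓ + 1 : ℕ) : ℝ)) ^ (blkV1 hN D x).1.1 ≤ (((ℓ + 1 : ℕ) : ℝ)) ^ 3 * ((sd : ℕ) : ℝ) := by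
      have h1 : (((ℓ + 1 : ℕ) : ℝ)) ^ ((blkV1 hN D x).1.1 - 3) ≤ ((sd : ℕ) : ℝ) := by exact_mod_cast hfar.le
      have hL1' : (1 : ℝ) ≤ ((ℓ + 1 : ℕ) : ℝ) := by rw [hcast]; exact hL1
      calc (((ℓ + 1 : ℕ) : ℝ)) ^ (blkV1 hN D x).1.1 ≤ (((ℓ + 1 : ℕ) : ℝ)) ^ (3 + ((blkV1 hN D x).1.1 - 3)) :=
            pow_le_pow_right₀ hL1' (by omega)
        _ = (((ℓ + 1 : ℕ) : ℝ)) ^ 3 * (((ℓ + 1 : ℕ) : ℝ)) ^ ((blkV1 hN D x).1.1 - 3) := pow_add _ _ _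
        _ ≤ (((ℓ + 1 : ℕ) : ℝ)) ^ 3 * ((sd : ℕ) : ℝ) := mul_le_mul_of_nonneg_left h1 (by positivity)
    have hL3t : 1 ≤ ((ℓ : ℝ) + 1) ^ 3 * t ^ α := by
      have h1 : 1 ≤ (((ℓ + 1 : ℕ) : ℝ)) ^ 3 * t := by
        rw [ht, mul_div_assoc', one_le_div hpx]; exact hkey
      rw [hcast] at h1
      exact h1.trans (mul_le_mul_of_nonneg_left htα (by positivity))
    -- comparison of the two output blocks
    have hlen : (geomT D).len (blkV1 hN D x') * |cf|⁻¹ ≤ ((ℓ : ℝ) + 1) * ((geomT D).len (blkV1 hN D x) * |cf|⁻¹) := by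
      rw [geomT_len, geomT_len, mul_one, mul_one, ← mul_assoc, ← pow_succ']
      exact mul_le_mul_of_nonneg_right (pow_le_pow_right₀ hL1 hjj) (inv_nonneg.2 (abs_nonneg _))
    obtain ⟨htri, -, -⟩ := triangle_refl_nonneg_T D hMh1 hP
    rw [mul_assoc]
    set S : Module.End ℝ (PBond (PV d ℓ m K hd hL) 0 → ℝ) := onFun (GE (domT hN D hk) hcf hw) * DVa ν cf with hS
    refine hasMajorant_pairOp_mul _ x x' (fun y y' => mul_nonneg (mul_nonneg (by positivity) (mul_nonneg htα0 (hlen0 y).le))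
      (Real.exp_nonneg _)) fun y' μ B hμ => ?_
    have hB0 : 0 ≤ B := hμ.nonneg
    have h1 : |S μ x| ≤
        A₃ * ((geomT D).len (blkV1 hN D x) * |cf|⁻¹) * Real.exp (-(δ₃ * (geomT D).dist (blkV1 hN D x) y')) * B := hE3 y' μ B hμ x
    have h2 : |S μ x'| ≤
        A₃ * ((geomT D).len (blkV1 hN D x') * |cf|⁻¹) * Real.exp (-(δ₃ * (geomT D).dist (blkV1 hN D x') y')) * B := hE3 y' μ B hμ x'
    -- move the bound at `x′` to the block of `x`
    have hexp : Real.exp (-(δ₃ * (geomT D).dist (blkV1 hN D x') y')) ≤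
        Real.exp (δ₃ * r₀) * Real.exp (-(δ₃ * (geomT D).dist (blkV1 hN D x) y')) := by
      rw [← Real.exp_add]
      refine Real.exp_le_exp.2 ?_
      have h := (htri (blkV1 hN D x) (blkV1 hN D x') y').trans (add_le_add hG2 le_rfl)
      have h' := mul_le_mul_of_nonneg_left h hδ₃.le
      linarith
    have hrate : Real.exp (-(δ₃ * (geomT D).dist (blkV1 hN D x) y')) ≤ Real.exp (-(min (σ₀ / 4) δ₃ * (geomT D).dist (blkV1 hN D x) y')) :=
      Real.exp_le_exp.2 (neg_le_neg (mul_le_mul_of_nonneg_right (min_le_right _ _) (hdnn _ _)))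
    set ℓx : ℝ := (geomT D).len (blkV1 hN D x) * |cf|⁻¹ with hℓx
    set Ex : ℝ := Real.exp (-(δ₃ * (geomT D).dist (blkV1 hN D x) y')) with hEx
    set E : ℝ := Real.exp (-(min (σ₀ / 4) δ₃ * (geomT D).dist (blkV1 hN D x) y')) with hE
    have hℓx0 : 0 ≤ ℓx := (hlen0 _).le
    have hEx0 : 0 ≤ Ex := Real.exp_nonneg _
    have hE0 : 0 ≤ E := Real.exp_nonneg _
    have h2' : |S μ x'| ≤ A₃ * (((ℓ : ℝ) + 1) * ℓx) * (Real.exp (δ₃ * r₀) * Ex) * B := by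
      refine h2.trans ?_
      have hl0 : 0 ≤ (geomT D).len (blkV1 hN D x') * |cf|⁻¹ := (hlen0 _).le
      gcongr
    calc |S μ x - S μ x'|
        ≤ |S μ x| + |S μ x'| := abs_sub _ _
      _ ≤ A₃ * ℓx * Ex * B + A₃ * (((ℓ : ℝ) + 1) * ℓx) * (Real.exp (δ₃ * r₀) * Ex) * B := add_le_add h1 h2'
      _ = A₃ * (1 + ((ℓ : ℝ) + 1) * Real.exp (δ₃ * r₀)) * 1 * ℓx * Ex * B := by ring
      _ ≤ A₃ * (1 + ((ℓ : ℝ) + 1) * Real.exp (δ₃ * r₀)) * (((ℓ : ℝ) + 1) ^ 3 * t ^ α) * ℓx * E * B := by gcongr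
      _ = Af * (t ^ α * ℓx) * E * B := by rw [hAf]; ring
      _ ≤ (An * ((ℓ : ℝ) + 1) + Af) * (t ^ α * ℓx) * E * B := by gcongr; linarith [mul_nonneg hAn (zero_le_one.trans hL1)]


end Literature.MathematicalPhysics.QuantumFieldTheory.Balaban1983to89.B6Prop26HolderDivCensusV1
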